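import Literature.MathematicalPhysics.QuantumFieldTheory.YangMillsOS
import Literature.MathematicalPhysics.QuantumLattice.LatticeGaugeDLRGibbsProofs
import Literature.Probability.LatticeModels.GibbsSpecificationDLRProofs
import Summits.QuantumFields.YangMills.Theses.CertificationLength
import Summits.QuantumFields.YangMills.Theorems.ConvexGribovBodyNonSimplyConnectedLatticeGapStubBoxInfluenceInward
import Summits.QuantumFields.YangMills.Theorems.ConvexGribovBodyNonSimplyConnectedLatticeGapStubBoxInfluenceDecayAtOfCellFiniteSize
import Summits.QuantumFields.YangMills.Theorems.ConvexGribovBodyNonSimplyConnectedLatticeGapStubGaugeInvariantUniqueness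
import Summits.QuantumFields.YangMills.Theorems.ConvexGribovBodyNonSimplyConnectedLatticeGapStubDlrGaugeInvariant
import Summits.QuantumFields.YangMills.Theorems.ConvexGribovBodyNonSimplyConnectedLatticeGapStubDlrEqOfGaugeInvariantAgreement
import HarnessLib

/-!
# No staggered phase at weak coupling (stub NS of crux `FibreToTorus`, line `Sketch`): reductions

Stub `stub_fibreTranslationInvariance` (NS) of the skeleton `Cruxes/FibreToTorus/Lines/Sketch.lean` of item
stmt-QuantumFields-16244 (route `ContractibleFibre`) asks: for every compact simple `G` and faithful unitary `r`
there is `β_s` such that at every `β ≥ β_s` a DLR state of the Wilson specification `ymSpecification r.ρ β` on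
`ℤ⁴` which is invariant under the unit translations `e₀, e₁` and `e₀`-mixing on bounded measurable functions is
invariant under ALL lattice translations.  This is an open weak-coupling statement (absence of fibre-staggered
pure phases); this file does NOT prove it.  It records, kernel-checked, where NS sits:

* `map_configShift_mem_ymGibbsMeasures` — **translation covariance of the DLR set**: `𝒢(β)` is mapped to itself
  by every lattice translation `θ_v = configShift v` (the kernels are covariant,
  `ymSpecification_map_configShift`; Georgii 2011, §5.1, (5.7)–(5.10)).
* `isZdTranslationInvariant_of_subsingleton` — hence if `|𝒢(β)| ≤ 1` every DLR state is `ℤ^d`-invariant.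
* `fibreTranslationInvariance_of_gaugeInvariantUniqueness` — **NS ≤ U**: the previous line's stub U
  (`GaugeInvariantUniqueness`: at `β ≥ β_u` all DLR states agree on every gauge-invariant local observable)
  implies NS, WITHOUT the invariance and mixing hypotheses, because U is full DLR uniqueness by Elitzur's theorem in
  DLR form (`stub_dlr_gaugeInvariant`) and gauge averaging (`stub_dlr_eq_of_gaugeInvariantAgreement`).
* `fibreTranslationInvariance_of_completeAnalyticityAtLargeScales` — **NS ≤ (A)**: the open crux
  `CertificationLength.CompleteAnalyticityAtLargeScales` (stmt-QuantumFields-16178) implies NS, through the landed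
  chain finite-size condition ⇒ cube-influence decay (`stub_boxInfluenceDecayAt_of_cellFiniteSize`) ⇒ agreement
  on gauge invariants (`stub_gaugeInvariantUniqueness_of_boxInfluenceDecay`) ⇒ DLR uniqueness ⇒ invariance.

The conclusion of the last two theorems is the registered signature of `stub_fibreTranslationInvariance`
verbatim, so the skeleton may discharge NS by `fibreTranslationInvariance_of_completeAnalyticityAtLargeScales h`
from `h : CompleteAnalyticityAtLargeScales`.  Audit (no cheap refutation): `𝒢(β)` is non-empty with
`ℤ⁴`-invariant members (periodic limit points), `IsGibbsMeasure` carries `IsProbabilityMeasure`, and every DLR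
state is gauge invariant (`stub_dlr_gaugeInvariant`), so gauge images of a DLR state give no non-invariant DLR state.

References: H.-O. Georgii, *Gibbs Measures and Phase Transitions* (2011), §5.1, §8.2; E. Seiler, LNP 159 (1982),
Ch. 2; R. L. Dobrushin, S. B. Shlosman (1985), §2.
-/

set_option autoImplicit false

noncomputable section

open MeasureTheory Filter Topology
open Literature.Probability.LatticeModels (Site IsGibbsMeasure IsSpecification)
open Literature.MathematicalPhysics.QuantumLattice (LGConfig ZdEdge edgeShift edgeShift_apply configShift
  configShift_apply ymSpecification ymGibbsMeasures mem_ymGibbsMeasures_iff IsZdTranslationInvariant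
  LocalGaugeObservable)
open Literature.MathematicalPhysics.QuantumFieldTheory hiding ZdEdge

namespace Summit.QuantumFields.YangMills.Theorems.FibreToTorus

section Covariance

variable {d N : ℕ} {G : Type*} [Group G] [TopologicalSpace G] [IsTopologicalGroup G] [CompactSpace G]
  [MeasurableSpace G] [BorelSpace G] [SecondCountableTopology G] [T2Space G]
  (ρ : G →* Matrix (Fin N) (Fin N) ℂ)

/-- **Translation covariance of the set of DLR states.** For a compact metrisable gauge group `G`, a continuous
representation `ρ` and any `β`: if `μ` is a DLR state of the Wilson specification `ymSpecification ρ β` on `ℤ^d`,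
so is its translate `μ ∘ θ_v⁻¹ = μ.map (configShift v)` for every `v ∈ ℤ^d`.  Proof: for a volume `Λ'` write
`Λ' = Λ + v` with `Λ = Λ' − v`; by covariance of the kernels (`ymSpecification_map_configShift`)
`γ_{Λ'}(A | θ_v η) = γ_Λ(θ_v⁻¹ A | η)`, so
`∫ γ_{Λ'}(A | η') (μ∘θ_v⁻¹)(dη') = ∫ γ_Λ(θ_v⁻¹ A | η) μ(dη) = μ(θ_v⁻¹ A)` by the DLR equation for `μ`
(Georgii 2011, §5.1, (5.7)–(5.10)). [folklore] -/
theorem map_configShift_mem_ymGibbsMeasures (hρ : Continuous ρ) (β : ℝ) {μ : Measure (LGConfig d G)}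
    (hμ : μ ∈ ymGibbsMeasures (d := d) ρ β) (v : Site d) :
    μ.map (configShift v) ∈ ymGibbsMeasures (d := d) ρ β := by
  rw [mem_ymGibbsMeasures_iff] at hμ ⊢
  haveI := hμ.isProbabilityMeasure
  have hγ : IsSpecification (ymSpecification (d := d) ρ β) :=
    isSpecification_ymSpecification_of_t2Space (d := d) ρ hρ β
  refine ⟨Measure.isProbabilityMeasure_map (configShift v).measurable.aemeasurable, fun Λ' A hA => ?_⟩
  -- `Λ' = Λ + v` with `Λ = Λ' - v`
  set Λ : Finset (ZdEdge d) := Λ'.map (edgeShift (-v)).toEmbedding with hΛ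
  have hΛ' : Λ' = Λ.map (edgeShift v).toEmbedding := by
    rw [hΛ, Finset.map_map]
    have h : (edgeShift (d := d) (-v)).toEmbedding.trans (edgeShift v).toEmbedding =
        Function.Embedding.refl _ := by
      ext e : 1
      simp [edgeShift_apply]
    rw [h, Finset.map_refl]
  rw [lintegral_map (hγ.measurable_coe Λ' hA) (configShift v).measurable,
    Measure.map_apply (configShift v).measurable hA]
  have hpt : ∀ η : LGConfig d G, ymSpecification ρ β Λ' (configShift v η) A =
      ymSpecification ρ β Λ η (configShift v ⁻¹' A) := fun η => by
    rw [hΛ', ← NonSimplyConnectedLatticeGap.ymSpecification_map_configShift ρ hρ β Λ v η,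
      Measure.map_apply (configShift v).measurable hA]
  simp_rw [hpt]
  exact hμ.2 Λ _ ((configShift v).measurable hA)

/-- **DLR uniqueness forces translation invariance**: if `𝒢(β)` has at most one element, every DLR state of
`ymSpecification ρ β` is invariant under all lattice translations (its translates are DLR states,
`map_configShift_mem_ymGibbsMeasures`) (Georgii 2011, §5.1). [folklore] -/
theorem isZdTranslationInvariant_of_subsingleton (hρ : Continuous ρ) (β : ℝ)
    (h : (ymGibbsMeasures (d := d) ρ β).Subsingleton) {μ : Measure (LGConfig d G)}
    (hμ : μ ∈ ymGibbsMeasures (d := d) ρ β) : IsZdTranslationInvariant μ :=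
  fun v => h (map_configShift_mem_ymGibbsMeasures ρ hρ β hμ v) hμ

end Covariance

/-- **NS ≤ U.** Weak-coupling DLR uniqueness on the gauge-invariant algebra (the statement
`GaugeInvariantUniqueness` = stub U of line `uniqueness` of this crux, taken here as an explicit hypothesis)
implies the statement of stub NS (`FibreTranslationInvariance`), with the same threshold and without using the
invariance and mixing hypotheses: U upgrades to full DLR uniqueness by `stub_dlr_gaugeInvariant` (every DLR state
is gauge invariant) and `stub_dlr_eq_of_gaugeInvariantAgreement` (gauge-invariant states agreeing on gauge
invariants coincide), and a unique DLR state is translation invariant (`isZdTranslationInvariant_of_subsingleton`).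
Hausdorffness and second countability of `G` come from the faithful representation `r`. [folklore] -/
theorem fibreTranslationInvariance_of_gaugeInvariantUniqueness
    (hU : ∀ (G : Type) [Group G] [TopologicalSpace G] [IsTopologicalGroup G] [CompactSpace G]
      [MeasurableSpace G] [BorelSpace G], IsCompactSimpleLieGroup G → ∀ r : LatticeRep G,
      ∃ βu : ℝ, ∀ β : ℝ, βu ≤ β → ∀ μ ν : MeasureTheory.Measure (LGConfig 4 G),
        μ ∈ ymGibbsMeasures (d := 4) r.ρ β → ν ∈ ymGibbsMeasures (d := 4) r.ρ β →
          ∀ A : YMSpecies G, ∫ U, A.F U ∂μ = ∫ U, A.F U ∂ν) :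
    ∀ (G : Type) [Group G] [TopologicalSpace G] [IsTopologicalGroup G] [CompactSpace G]
      [MeasurableSpace G] [BorelSpace G], IsCompactSimpleLieGroup G → ∀ r : LatticeRep G,
      ∃ βs : ℝ, ∀ β : ℝ, βs ≤ β → ∀ μ : MeasureTheory.Measure (LGConfig 4 G),
        μ ∈ ymGibbsMeasures (d := 4) r.ρ β →
        (μ.map (configShift (Pi.single 0 1)) = μ ∧ μ.map (configShift (Pi.single 1 1)) = μ) →
        (∀ F H : LGConfig 4 G → ℝ, Measurable F → Measurable H → (∀ U, |F U| ≤ 1) → (∀ U, |H U| ≤ 1) →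
          Filter.Tendsto (fun n : ℕ =>
            (∫ U, F U * H (configShift (-Pi.single 0 (n : ℤ)) U) ∂μ) -
              (∫ U, F U ∂μ) * ∫ U, H (configShift (-Pi.single 0 (n : ℤ)) U) ∂μ) Filter.atTop (nhds 0)) →
        IsZdTranslationInvariant μ := by
  intro G _ _ _ _ _ _ hG r
  obtain ⟨βu, hβu⟩ := hU G hG r
  refine ⟨βu, fun β hβ μ hμ _ _ => ?_⟩
  haveI : T2Space G := (r.continuous.isClosedEmbedding r.injective).isEmbedding.t2Space
  haveI : SecondCountableTopology G :=
    (r.continuous.isClosedEmbedding r.injective).isEmbedding.secondCountableTopology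
  refine isZdTranslationInvariant_of_subsingleton r.ρ r.continuous β (fun κ hκ ν hν => ?_) hμ
  exact NonSimplyConnectedLatticeGap.stub_dlr_eq_of_gaugeInvariantAgreement G r.N r.ρ r.continuous β κ ν hκ hν
    (NonSimplyConnectedLatticeGap.stub_dlr_gaugeInvariant G r.N r.ρ r.continuous β κ hκ)
    (NonSimplyConnectedLatticeGap.stub_dlr_gaugeInvariant G r.N r.ρ r.continuous β ν hν)
    (hβu β hβ κ ν hκ hν)

/-- **NS ≤ (A).** The open crux `CertificationLength.CompleteAnalyticityAtLargeScales`
(stmt-QuantumFields-16178: at every `β ≥ β₂(B)` some cell size `b ≥ B` satisfies the Dobrushin–Shlosman TV finite-size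
condition for `ymSpecification r.ρ β`) implies the statement of stub NS verbatim, with `β_s := β₂(1)`: at such `β`
the finite-size condition gives exponential decay of the cube influence of every gauge-invariant local observable
(`stub_boxInfluenceDecayAt_of_cellFiniteSize`), hence agreement of all DLR states on gauge invariants
(`stub_gaugeInvariantUniqueness_of_boxInfluenceDecay`), hence DLR uniqueness (`stub_dlr_gaugeInvariant`,
`stub_dlr_eq_of_gaugeInvariantAgreement`), hence translation invariance of every DLR state
(`isZdTranslationInvariant_of_subsingleton`).  (A) is stated on the Borel σ-algebra `borel G`; any
`[BorelSpace G]` structure is propositionally it. [folklore] -/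
theorem fibreTranslationInvariance_of_completeAnalyticityAtLargeScales :
    Summit.QuantumFields.YangMills.Theses.CertificationLength.CompleteAnalyticityAtLargeScales →
    ∀ (G : Type) [Group G] [TopologicalSpace G] [IsTopologicalGroup G] [CompactSpace G]
      [MeasurableSpace G] [BorelSpace G], IsCompactSimpleLieGroup G → ∀ r : LatticeRep G,
      ∃ βs : ℝ, ∀ β : ℝ, βs ≤ β → ∀ μ : MeasureTheory.Measure (LGConfig 4 G),
        μ ∈ ymGibbsMeasures (d := 4) r.ρ β →
        (μ.map (configShift (Pi.single 0 1)) = μ ∧ μ.map (configShift (Pi.single 1 1)) = μ) →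
        (∀ F H : LGConfig 4 G → ℝ, Measurable F → Measurable H → (∀ U, |F U| ≤ 1) → (∀ U, |H U| ≤ 1) →
          Filter.Tendsto (fun n : ℕ =>
            (∫ U, F U * H (configShift (-Pi.single 0 (n : ℤ)) U) ∂μ) -
              (∫ U, F U ∂μ) * ∫ U, H (configShift (-Pi.single 0 (n : ℤ)) U) ∂μ) Filter.atTop (nhds 0)) →
        IsZdTranslationInvariant μ := by
  intro hA G _ _ _ _ instM instB hG r
  -- (A) lives on `borel G`: identify the given Borel structure with it
  obtain ⟨hmeas⟩ := instB
  subst hmeas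
  letI : MeasurableSpace G := borel G
  haveI : BorelSpace G := ⟨rfl⟩
  haveI : T2Space G := (r.continuous.isClosedEmbedding r.injective).isEmbedding.t2Space
  haveI : SecondCountableTopology G :=
    (r.continuous.isClosedEmbedding r.injective).isEmbedding.secondCountableTopology
  obtain ⟨n, ε, hn, hε, hq, hB⟩ := hA G hG r
  obtain ⟨β₂, hβ₂⟩ := hB 1
  refine ⟨β₂, fun β hβ μ hμ _ _ => ?_⟩
  obtain ⟨b, -, hb, hFS⟩ := hβ₂ β hβ
  obtain ⟨m, hm, hdec⟩ := NonSimplyConnectedLatticeGap.stub_boxInfluenceDecayAt_of_cellFiniteSize G r.N r.ρ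
    r.continuous β n ε b hn hε hq hb hFS
  refine isZdTranslationInvariant_of_subsingleton r.ρ r.continuous β (fun κ hκ ν hν => ?_) hμ
  exact NonSimplyConnectedLatticeGap.stub_dlr_eq_of_gaugeInvariantAgreement G r.N r.ρ r.continuous β κ ν hκ hν
    (NonSimplyConnectedLatticeGap.stub_dlr_gaugeInvariant G r.N r.ρ r.continuous β κ hκ)
    (NonSimplyConnectedLatticeGap.stub_dlr_gaugeInvariant G r.N r.ρ r.continuous β ν hν)
    (NonSimplyConnectedLatticeGap.stub_gaugeInvariantUniqueness_of_boxInfluenceDecay G r.N r.ρ r.continuous β m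
      hm hdec κ ν hκ hν)

end Summit.QuantumFields.YangMills.Theorems.FibreToTorus

end
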